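import Summits.CriticalPhenomena.Ising3DConformalLimit.Theses.BallSpecification
import Literature.Probability.LatticeModels.MoebiusWeightedAction
import HarnessLib

/-!
# Stub `stub_transportSymmetries` of line `birth` (skeleton r5) for crux `BallSpecifiedInversionUpgrade` (stmt-CriticalPhenomena-11248)

Route `route-CriticalPhenomena-BallSpecification`, sub-problem `Ising3DConformalLimit`.  Target tree file:
`Summits/CriticalPhenomena/Ising3DConformalLimit/Theorems/BallSpecificationBallSpecifiedInversionUpgradeTransportSymmetries.lean`,
landed with `--supports stmt-CriticalPhenomena-11248`.

**Content (model-free bookkeeping, r5 of line `birth`).**  Let `μ` be a law on `𝓢'(ℝ³)` that is Euclidean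
invariant and dilation covariant with weight `Δ` (`(act (s^(Δ-3) • dilateTest s))_* μ = μ`; two clauses of the
crux antecedent `H`), and let `P s` be truncated inversion operators, exact (`P s f = ι^*_Δ f`) on test functions
compactly supported in the annulus `R_s = {s < ‖x‖ < s⁻¹}` (stub `stub_truncatedInversionCLM`, landed).  Then the
transported family `ν_s := (act (P s))_* μ` — the truncations of the inverted law `ι_* μ` — is
* (DI) DILATION STATIONARY with the same weight: `ν_s ((act (l^(Δ-3) • dilateTest l))⁻¹ A) = ν_{s'} (A)` for every
  event `A` seen in `R_{s'}` whenever the dilation by `l` maps `R_{s'}`-supported test functions into `R_s`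
  (`s ≤ l s'`, `l s ≤ s'`), because `ι^*_Δ ∘ (l^(Δ-3) D_l) = (l^(3-Δ) D_{l⁻¹}) ∘ ι^*_Δ` on test functions supported
  off `0` and `μ` is dilation covariant at scale `l⁻¹`;
* (RI) ROTATION INVARIANT: `ν_s ((rotateField L)⁻¹ A) = ν_s (A)` for every linear isometry `L` and every event
  `A` seen in `R_s`, because `ι^*_Δ` commutes with `f ↦ f ∘ L` and `μ` is rotation invariant.
These are the symmetries of `ι_* μ` that survive the puncture (the stabiliser of `{0, ∞}` in the similarity
group); r5 adds them to the hypotheses on competitors in the punctured-uniqueness clause (PU') and in the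
shell-tilt rigidity stub, which then only have to defeat dilation-stationary, isotropic competitors.
-/

namespace Summit.CriticalPhenomena.Ising3DConformalLimit.BallSpecificationBallSpecifiedInversionUpgrade

open MeasureTheory
open Literature.MathematicalPhysics.QuantumLattice Literature.Probability.LatticeModels

/-! ### Private helpers (prefix `ts_`) -/

/-- The annulus `R_s` misses the origin (for `0 < s`). [folklore] -/
private theorem ts_annulus_subset_compl_zero {s : ℝ} (hs : 0 < s) :
    {x : EuclideanSpace ℝ (Fin 3) | s < ‖x‖ ∧ ‖x‖ < s⁻¹} ⊆
      (({0} : Set (EuclideanSpace ℝ (Fin 3)))ᶜ) :=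
  fun _ hx => Set.mem_compl_singleton_iff.2 (norm_pos_iff.1 (hs.trans hx.1))

/-- A test function whose topological support lies in an annulus `R_s` has compact support. [folklore] -/
private theorem ts_hasCompactSupport_of_subset_annulus {s : ℝ}
    {f : SchwartzMap (EuclideanSpace ℝ (Fin 3)) ℝ}
    (hf : tsupport (f : EuclideanSpace ℝ (Fin 3) → ℝ) ⊆
      {x : EuclideanSpace ℝ (Fin 3) | s < ‖x‖ ∧ ‖x‖ < s⁻¹}) :
    HasCompactSupport (f : EuclideanSpace ℝ (Fin 3) → ℝ) := by
  refine Metric.isCompact_of_isClosed_isBounded (isClosed_tsupport _)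
    ((Metric.isBounded_ball (x := (0 : EuclideanSpace ℝ (Fin 3))) (r := s⁻¹)).subset ?_)
  intro x hx
  rw [Metric.mem_ball, dist_zero_right]
  exact (hf hx).2

/-- **σ-algebra induction.** If two maps of field configurations agree when tested against every
test function supported in `U`, they have the same preimage of every event seen in `U`. [folklore] -/
private theorem ts_preimage_eq_of_extEvents {U : Set (EuclideanSpace ℝ (Fin 3))}
    {T T' : FieldConfig (EuclideanSpace ℝ (Fin 3)) → FieldConfig (EuclideanSpace ℝ (Fin 3))}
    (h : ∀ f : SchwartzMap (EuclideanSpace ℝ (Fin 3)) ℝ,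
      tsupport (f : EuclideanSpace ℝ (Fin 3) → ℝ) ⊆ U → ∀ ω, T ω f = T' ω f)
    {A : Set (FieldConfig (EuclideanSpace ℝ (Fin 3)))} (hA : MeasurableSet[extEvents U] A) :
    T ⁻¹' A = T' ⁻¹' A := by
  suffices hle : extEvents U ≤
      { MeasurableSet' := fun B => T ⁻¹' B = T' ⁻¹' B
        measurableSet_empty := rfl
        measurableSet_compl := fun B hB => by
          show T ⁻¹' Bᶜ = T' ⁻¹' Bᶜ
          rw [Set.preimage_compl, Set.preimage_compl, hB]
        measurableSet_iUnion := fun B hB => by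
          show T ⁻¹' (⋃ i, B i) = T' ⁻¹' (⋃ i, B i)
          rw [Set.preimage_iUnion, Set.preimage_iUnion]
          exact Set.iUnion_congr hB } from
    hle A hA
  refine iSup₂_le fun f hf => ?_
  intro B hB
  obtain ⟨t, -, rfl⟩ := MeasurableSpace.measurableSet_comap.1 hB
  show T ⁻¹' ((fun ω : FieldConfig (EuclideanSpace ℝ (Fin 3)) => ω f) ⁻¹' t) =
    T' ⁻¹' ((fun ω : FieldConfig (EuclideanSpace ℝ (Fin 3)) => ω f) ⁻¹' t)
  ext ω
  rw [Set.mem_preimage, Set.mem_preimage, Set.mem_preimage, Set.mem_preimage, h f hf ω]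

/-! ### Dilations of test functions: support bookkeeping and commutation with `ι^*_Δ` -/

/-- Dilation preserves compact support. [folklore] -/
private theorem ts_hasCompactSupport_dilateTest {l : ℝ} (hl : l ≠ 0)
    {f : SchwartzMap (EuclideanSpace ℝ (Fin 3)) ℝ}
    (hf : HasCompactSupport (f : EuclideanSpace ℝ (Fin 3) → ℝ)) :
    HasCompactSupport ((dilateTest l hl f : SchwartzMap (EuclideanSpace ℝ (Fin 3)) ℝ) :
      EuclideanSpace ℝ (Fin 3) → ℝ) := by
  have h : ((dilateTest l hl f : SchwartzMap (EuclideanSpace ℝ (Fin 3)) ℝ) :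
      EuclideanSpace ℝ (Fin 3) → ℝ) = (f : EuclideanSpace ℝ (Fin 3) → ℝ) ∘
        (ContinuousLinearEquiv.smulLeft (Units.mk0 l hl)⁻¹ :
          EuclideanSpace ℝ (Fin 3) ≃L[ℝ] EuclideanSpace ℝ (Fin 3)).toHomeomorph := rfl
  rw [h]
  exact hf.comp_homeomorph _

/-- Supports of dilates: `x ∈ tsupport f(l⁻¹ ·) → l⁻¹ x ∈ tsupport f`. [folklore] -/
private theorem ts_inv_smul_mem_tsupport {l : ℝ} (hl : l ≠ 0)
    (f : SchwartzMap (EuclideanSpace ℝ (Fin 3)) ℝ) {x : EuclideanSpace ℝ (Fin 3)}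
    (hx : x ∈ tsupport ((dilateTest l hl f : SchwartzMap (EuclideanSpace ℝ (Fin 3)) ℝ) :
      EuclideanSpace ℝ (Fin 3) → ℝ)) :
    l⁻¹ • x ∈ tsupport (f : EuclideanSpace ℝ (Fin 3) → ℝ) := by
  have h : ((dilateTest l hl f : SchwartzMap (EuclideanSpace ℝ (Fin 3)) ℝ) :
      EuclideanSpace ℝ (Fin 3) → ℝ) = (f : EuclideanSpace ℝ (Fin 3) → ℝ) ∘ fun x => l⁻¹ • x :=
    funext fun y => dilateTest_apply l hl f y
  rw [h] at hx
  exact tsupport_comp_subset_preimage (f : EuclideanSpace ℝ (Fin 3) → ℝ) (continuous_const_smul l⁻¹) hx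

/-- Dilates of test functions supported off `0` are supported off `0`. [folklore] -/
private theorem ts_tsupport_dilateTest_subset_compl_zero {l : ℝ} (hl : l ≠ 0)
    {f : SchwartzMap (EuclideanSpace ℝ (Fin 3)) ℝ}
    (hf : tsupport (f : EuclideanSpace ℝ (Fin 3) → ℝ) ⊆ (({0} : Set (EuclideanSpace ℝ (Fin 3)))ᶜ)) :
    tsupport ((dilateTest l hl f : SchwartzMap (EuclideanSpace ℝ (Fin 3)) ℝ) :
      EuclideanSpace ℝ (Fin 3) → ℝ) ⊆ (({0} : Set (EuclideanSpace ℝ (Fin 3)))ᶜ) := by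
  intro x hx
  have h := hf (ts_inv_smul_mem_tsupport hl f hx)
  rw [Set.mem_compl_singleton_iff] at h ⊢
  intro hx0
  exact h (by rw [hx0, smul_zero])

/-- Dilation by `l` maps test functions supported in `R_{s'}` to test functions supported in `R_s`
when `s ≤ l s'` and `l s ≤ s'`. [folklore] -/
private theorem ts_tsupport_dilateTest_subset {l s s' : ℝ} (hl : 0 < l) (hs : 0 < s)
    (hsl : s ≤ l * s') (hls : l * s ≤ s') (hs' : 0 < s')
    {f : SchwartzMap (EuclideanSpace ℝ (Fin 3)) ℝ}
    (hf : tsupport (f : EuclideanSpace ℝ (Fin 3) → ℝ) ⊆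
      {x : EuclideanSpace ℝ (Fin 3) | s' < ‖x‖ ∧ ‖x‖ < s'⁻¹}) :
    tsupport ((dilateTest l hl.ne' f : SchwartzMap (EuclideanSpace ℝ (Fin 3)) ℝ) :
      EuclideanSpace ℝ (Fin 3) → ℝ) ⊆ {x : EuclideanSpace ℝ (Fin 3) | s < ‖x‖ ∧ ‖x‖ < s⁻¹} := by
  intro x hx
  have hx' := hf (ts_inv_smul_mem_tsupport hl.ne' f hx)
  rw [Set.mem_setOf_eq, norm_smul, norm_inv, Real.norm_of_nonneg hl.le] at hx'
  obtain ⟨h1, h2⟩ := hx'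
  rw [lt_inv_mul_iff₀ hl] at h1
  rw [inv_mul_lt_iff₀ hl] at h2
  refine ⟨lt_of_le_of_lt hsl h1, lt_of_lt_of_le h2 ?_⟩
  rw [mul_inv_le_iff₀ hs', le_inv_mul_iff₀ hs]
  simpa [mul_comm] using hls

/-- The unit inversion is homogeneous of degree `-1` under positive dilations:
`ι (l • x) = l⁻¹ • ι x`. [folklore] -/
private theorem ts_inversion_smul {l : ℝ} (hl : 0 < l) (x : EuclideanSpace ℝ (Fin 3)) :
    EuclideanGeometry.inversion (0 : EuclideanSpace ℝ (Fin 3)) 1 (l • x) =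
      l⁻¹ • EuclideanGeometry.inversion (0 : EuclideanSpace ℝ (Fin 3)) 1 x := by
  rw [← ConformalChart.unitInversion_apply, ← ConformalChart.unitInversion_apply,
    ConformalChart.unitInversion_apply_eq_smul, ConformalChart.unitInversion_apply_eq_smul,
    smul_smul, smul_smul, norm_smul, Real.norm_of_nonneg hl.le]
  by_cases hx : x = 0
  · rw [hx, smul_zero, smul_zero]
  · congr 1
    have hx' : ‖x‖ ≠ 0 := norm_ne_zero_iff.2 hx
    field_simp

/-- **`ι^*_Δ` intertwines the weight-`Δ` dilations `l^(Δ-3) D_l` and `l^(3-Δ) D_{l⁻¹}`** on test functions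
compactly supported off the origin: `ι^*_Δ (l^(Δ-3) f(l⁻¹ ·)) = (l⁻¹)^(Δ-3) (ι^*_Δ f)(l ·)`. [folklore] -/
private theorem ts_inversion_dilate (Δ : ℝ) {l : ℝ} (hl : 0 < l)
    {f : SchwartzMap (EuclideanSpace ℝ (Fin 3)) ℝ}
    (hf : HasCompactSupport (f : EuclideanSpace ℝ (Fin 3) → ℝ))
    (hf0 : tsupport (f : EuclideanSpace ℝ (Fin 3) → ℝ) ⊆ (({0} : Set (EuclideanSpace ℝ (Fin 3)))ᶜ)) :
    moebiusWeightedAction ConformalChart.unitInversion Δ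
        (((l ^ (Δ - 3)) • dilateTest l hl.ne') f) =
      ((l⁻¹ ^ (Δ - 3)) • dilateTest l⁻¹ (inv_pos.2 hl).ne')
        (moebiusWeightedAction ConformalChart.unitInversion Δ f) := by
  have hfc' := ts_hasCompactSupport_dilateTest hl.ne' hf
  have hf0' := ts_tsupport_dilateTest_subset_compl_zero hl.ne' hf0
  rw [_root_.smul_apply, _root_.smul_apply,
    moebiusWeightedAction_smul _ hfc' (by rwa [ConformalChart.unitInversion_target])]
  ext x
  rw [_root_.smul_apply, _root_.smul_apply, dilateTest_apply, inv_inv, smul_eq_mul,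
    smul_eq_mul]
  by_cases hx : x = 0
  · subst hx
    rw [smul_zero,
      moebiusWeightedAction_apply_of_not_mem _ (by simp [ConformalChart.unitInversion_source]),
      moebiusWeightedAction_apply_of_not_mem _ (by simp [ConformalChart.unitInversion_source]),
      mul_zero, mul_zero]
  · have hlx : l • x ≠ 0 := smul_ne_zero hl.ne' hx
    rw [moebiusWeightedAction_unitInversion_apply hfc' hf0' hx,
      moebiusWeightedAction_unitInversion_apply hf hf0 hlx, dilateTest_apply,
      ts_inversion_smul hl x, finrank_euclideanSpace_fin]
    have ha : 0 < ‖x‖ ^ 2 := by positivity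
    have h1 : ‖l • x‖ ^ 2 = l ^ 2 * ‖x‖ ^ 2 := by
      rw [norm_smul, Real.norm_of_nonneg hl.le, mul_pow]
    rw [h1, mul_inv, Real.mul_rpow (inv_nonneg.2 (sq_nonneg l)) (inv_nonneg.2 ha.le),
      Real.inv_rpow hl.le, Real.inv_rpow (sq_nonneg l), ← Real.rpow_natCast l 2,
      ← Real.rpow_mul hl.le, ← Real.rpow_neg hl.le, ← Real.rpow_neg hl.le]
    have key : l ^ (Δ - 3) = l ^ (-(Δ - 3)) * l ^ (-((2 : ℕ) * (((3 : ℕ) : ℝ) - Δ))) := by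
      rw [← Real.rpow_add hl]
      congr 1
      push_cast
      ring
    rw [key]
    ring

/-! ### Rotations of test functions: support bookkeeping and commutation with `ι^*_Δ` -/

/-- `linActTest L f = f ∘ L⁻¹` as functions. [folklore] -/
private theorem ts_coe_linActTest (L : EuclideanSpace ℝ (Fin 3) ≃ₗᵢ[ℝ] EuclideanSpace ℝ (Fin 3))
    (f : SchwartzMap (EuclideanSpace ℝ (Fin 3)) ℝ) :
    ((linActTest L f : SchwartzMap (EuclideanSpace ℝ (Fin 3)) ℝ) : EuclideanSpace ℝ (Fin 3) → ℝ) =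
      (f : EuclideanSpace ℝ (Fin 3) → ℝ) ∘ L.symm.toHomeomorph :=
  funext fun y => linActTest_apply L f y

/-- Rotation preserves compact support. [folklore] -/
private theorem ts_hasCompactSupport_linActTest
    (L : EuclideanSpace ℝ (Fin 3) ≃ₗᵢ[ℝ] EuclideanSpace ℝ (Fin 3))
    {f : SchwartzMap (EuclideanSpace ℝ (Fin 3)) ℝ}
    (hf : HasCompactSupport (f : EuclideanSpace ℝ (Fin 3) → ℝ)) :
    HasCompactSupport ((linActTest L f : SchwartzMap (EuclideanSpace ℝ (Fin 3)) ℝ) :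
      EuclideanSpace ℝ (Fin 3) → ℝ) := by
  rw [ts_coe_linActTest]
  exact hf.comp_homeomorph _

/-- Supports of rotated test functions: `x ∈ tsupport (f ∘ L⁻¹) → L⁻¹ x ∈ tsupport f`. [folklore] -/
private theorem ts_symm_mem_tsupport (L : EuclideanSpace ℝ (Fin 3) ≃ₗᵢ[ℝ] EuclideanSpace ℝ (Fin 3))
    (f : SchwartzMap (EuclideanSpace ℝ (Fin 3)) ℝ) {x : EuclideanSpace ℝ (Fin 3)}
    (hx : x ∈ tsupport ((linActTest L f : SchwartzMap (EuclideanSpace ℝ (Fin 3)) ℝ) :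
      EuclideanSpace ℝ (Fin 3) → ℝ)) :
    L.symm x ∈ tsupport (f : EuclideanSpace ℝ (Fin 3) → ℝ) := by
  rw [ts_coe_linActTest] at hx
  exact tsupport_comp_subset_preimage (f : EuclideanSpace ℝ (Fin 3) → ℝ)
    L.symm.toHomeomorph.continuous hx

/-- Rotations preserve the annuli `R_s` (as supports of test functions). [folklore] -/
private theorem ts_tsupport_linActTest_subset (L : EuclideanSpace ℝ (Fin 3) ≃ₗᵢ[ℝ] EuclideanSpace ℝ (Fin 3))
    {s : ℝ} {f : SchwartzMap (EuclideanSpace ℝ (Fin 3)) ℝ}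
    (hf : tsupport (f : EuclideanSpace ℝ (Fin 3) → ℝ) ⊆
      {x : EuclideanSpace ℝ (Fin 3) | s < ‖x‖ ∧ ‖x‖ < s⁻¹}) :
    tsupport ((linActTest L f : SchwartzMap (EuclideanSpace ℝ (Fin 3)) ℝ) :
      EuclideanSpace ℝ (Fin 3) → ℝ) ⊆ {x : EuclideanSpace ℝ (Fin 3) | s < ‖x‖ ∧ ‖x‖ < s⁻¹} := by
  intro x hx
  have h := hf (ts_symm_mem_tsupport L f hx)
  simpa only [Set.mem_setOf_eq, LinearIsometryEquiv.coe_toHomeomorph, LinearIsometryEquiv.norm_map] using h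

/-- Rotated test functions supported off `0` are supported off `0`. [folklore] -/
private theorem ts_tsupport_linActTest_subset_compl_zero
    (L : EuclideanSpace ℝ (Fin 3) ≃ₗᵢ[ℝ] EuclideanSpace ℝ (Fin 3))
    {f : SchwartzMap (EuclideanSpace ℝ (Fin 3)) ℝ}
    (hf : tsupport (f : EuclideanSpace ℝ (Fin 3) → ℝ) ⊆ (({0} : Set (EuclideanSpace ℝ (Fin 3)))ᶜ)) :
    tsupport ((linActTest L f : SchwartzMap (EuclideanSpace ℝ (Fin 3)) ℝ) :
      EuclideanSpace ℝ (Fin 3) → ℝ) ⊆ (({0} : Set (EuclideanSpace ℝ (Fin 3)))ᶜ) := by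
  intro x hx
  have h := hf (ts_symm_mem_tsupport L f hx)
  rw [Set.mem_compl_singleton_iff] at h ⊢
  intro hx0
  apply h
  simp [hx0]

/-- **`ι^*_Δ` commutes with rotations about the origin** on test functions compactly supported off
`0`: `ι^*_Δ (f ∘ L⁻¹) = (ι^*_Δ f) ∘ L⁻¹`. [folklore] -/
private theorem ts_inversion_rotate (Δ : ℝ) (L : EuclideanSpace ℝ (Fin 3) ≃ₗᵢ[ℝ] EuclideanSpace ℝ (Fin 3))
    {f : SchwartzMap (EuclideanSpace ℝ (Fin 3)) ℝ}
    (hf : HasCompactSupport (f : EuclideanSpace ℝ (Fin 3) → ℝ))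
    (hf0 : tsupport (f : EuclideanSpace ℝ (Fin 3) → ℝ) ⊆ (({0} : Set (EuclideanSpace ℝ (Fin 3)))ᶜ)) :
    moebiusWeightedAction ConformalChart.unitInversion Δ (linActTest L f) =
      linActTest L (moebiusWeightedAction ConformalChart.unitInversion Δ f) := by
  have hfc' := ts_hasCompactSupport_linActTest L hf
  have hf0' := ts_tsupport_linActTest_subset_compl_zero L hf0
  ext x
  rw [linActTest_apply]
  by_cases hx : x = 0
  · subst hx
    have h0 : L.symm 0 = 0 := LinearIsometryEquiv.map_zero _
    rw [h0,
      moebiusWeightedAction_apply_of_not_mem _ (by simp [ConformalChart.unitInversion_source]),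
      moebiusWeightedAction_apply_of_not_mem _ (by simp [ConformalChart.unitInversion_source])]
  · have hLx : L.symm x ≠ 0 := fun h => hx (by simpa using congrArg L h)
    rw [moebiusWeightedAction_unitInversion_apply hfc' hf0' hx,
      moebiusWeightedAction_unitInversion_apply hf hf0 hLx, linActTest_apply,
      LinearIsometryEquiv.norm_map, ← ConformalChart.unitInversion_apply,
      ← ConformalChart.unitInversion_apply, ConformalChart.unitInversion_apply_eq_smul,
      ConformalChart.unitInversion_apply_eq_smul, LinearIsometryEquiv.norm_map,
      LinearIsometryEquiv.map_smul]

/-! ### The registered stub -/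

/-- Registered stub `stub_transportSymmetries` of crux `BallSpecifiedInversionUpgrade`
(stmt-CriticalPhenomena-11248), line `birth` r5: the transported family `(act (P s))_* μ` of a Euclidean-invariant,
weight-`Δ` dilation-covariant law `μ` along truncated inversion operators `P s` (exact on `R_s`) is
(DI) dilation stationary with weight `Δ` across the annuli and (RI) rotation invariant on each annulus. [folklore] -/
theorem stub_transportSymmetries :
    ∀ (Δ : ℝ) (μ : MeasureTheory.Measure (Literature.MathematicalPhysics.QuantumLattice.FieldConfig (EuclideanSpace ℝ (Fin 3)))) (P : ℝ → (SchwartzMap (EuclideanSpace ℝ (Fin 3)) ℝ →L[ℝ] SchwartzMap (EuclideanSpace ℝ (Fin 3)) ℝ)), Literature.MathematicalPhysics.QuantumLattice.IsEuclideanInvariantLaw μ → (∀ (s : ℝ) (hs : 0 < s), MeasureTheory.Measure.map (Literature.MathematicalPhysics.QuantumLattice.FieldConfig.act ((s ^ (Δ - 3)) • Literature.MathematicalPhysics.QuantumLattice.dilateTest s hs.ne')) μ = μ) → (∀ s : ℝ, 0 < s → s < 1 → ∀ f : SchwartzMap (EuclideanSpace ℝ (Fin 3)) ℝ, HasCompactSupport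 (f : EuclideanSpace ℝ (Fin 3) → ℝ) → tsupport (f : EuclideanSpace ℝ (Fin 3) → ℝ) ⊆ {x : EuclideanSpace ℝ (Fin 3) | s < ‖x‖ ∧ ‖x‖ < s⁻¹} → P s f = Literature.Probability.LatticeModels.moebiusWeightedAction Literature.Probability.LatticeModels.ConformalChart.unitInversion Δ f) → (∀ (l : ℝ) (hl : 0 < l) (s s' : ℝ), 0 < s → s ≤ l * s' → l * s ≤ s' → s' < 1 → ∀ A, MeasurableSet[Literature.MathematicalPhysics.QuantumLattice.extEvents {x : EuclideanSpace ℝ (Fin 3) | s' < ‖x‖ ∧ ‖x‖ < s'⁻¹}] A → (MeasureTheory.Measure.map (Literature.MathematicalPhysics.QuantumLattice.FieldConfig.act (P s)) μ) ((Literature.MathematicalPhysics.QuantumLattice.FieldConfig.act ((l ^ (Δ - 3)) • Literature.MathematicalPhysics.QuantumLattice.dilateTest l hl.ne')) ⁻¹' A) = (MeasureTheory.Measure.map (Literature.MathematicalPhysics.QuantumLattice.FieldConfig.act (P s')) μ) A) ∧ (∀ (L : EuclideanSpace ℝ (Fin 3) ≃ₗᵢ[ℝ] EuclideanSpace ℝ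 (Fin 3)) (s : ℝ), 0 < s → s < 1 → ∀ A, MeasurableSet[Literature.MathematicalPhysics.QuantumLattice.extEvents {x : EuclideanSpace ℝ (Fin 3) | s < ‖x‖ ∧ ‖x‖ < s⁻¹}] A → (MeasureTheory.Measure.map (Literature.MathematicalPhysics.QuantumLattice.FieldConfig.act (P s)) μ) ((Literature.MathematicalPhysics.QuantumLattice.rotateField L) ⁻¹' A) = (MeasureTheory.Measure.map (Literature.MathematicalPhysics.QuantumLattice.FieldConfig.act (P s)) μ) A) := by
  intro Δ μ P hE hdil hP3
  refine ⟨?_, ?_⟩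
  · -- (DI) dilation stationarity across the annuli
    intro l hl s s' hs hsl hls hs'1 A hA
    have hls' : 0 < l * s := mul_pos hl hs
    have hs' : 0 < s' := lt_of_lt_of_le hls' hls
    have hss' : s ≤ s' := by nlinarith
    have hs1 : s < 1 := lt_of_le_of_lt hss' hs'1
    have hA' : MeasurableSet A := extEvents_le _ A hA
    have hdil' := hdil l⁻¹ (inv_pos.2 hl)
    rw [Measure.map_apply (FieldConfig.measurable_act _)
        (measurableSet_preimage (FieldConfig.measurable_act _) hA'),
      Measure.map_apply (FieldConfig.measurable_act _) hA']
    conv_rhs => rw [← hdil', Measure.map_apply (FieldConfig.measurable_act _)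
      (measurableSet_preimage (FieldConfig.measurable_act _) hA')]
    rw [← Set.preimage_comp, ← Set.preimage_comp]
    congr 1
    refine ts_preimage_eq_of_extEvents (fun f hf ω => ?_) hA
    have hfc : HasCompactSupport (f : EuclideanSpace ℝ (Fin 3) → ℝ) :=
      ts_hasCompactSupport_of_subset_annulus hf
    have hDf := ts_tsupport_dilateTest_subset hl hs hsl hls hs' hf
    have hDfc : HasCompactSupport ((((l ^ (Δ - 3)) • dilateTest l hl.ne') f :
        SchwartzMap (EuclideanSpace ℝ (Fin 3)) ℝ) : EuclideanSpace ℝ (Fin 3) → ℝ) := by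
      rw [_root_.smul_apply, FunLike.coe_smul]
      exact (ts_hasCompactSupport_dilateTest hl.ne' hfc).smul_left
    have hDfs : tsupport ((((l ^ (Δ - 3)) • dilateTest l hl.ne') f :
        SchwartzMap (EuclideanSpace ℝ (Fin 3)) ℝ) : EuclideanSpace ℝ (Fin 3) → ℝ) ⊆
        {x : EuclideanSpace ℝ (Fin 3) | s < ‖x‖ ∧ ‖x‖ < s⁻¹} := by
      rw [_root_.smul_apply, FunLike.coe_smul]
      exact (tsupport_smul_subset_right (fun _ : EuclideanSpace ℝ (Fin 3) => l ^ (Δ - 3)) _).trans hDf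
    simp only [Function.comp_apply, FieldConfig.act_apply]
    rw [hP3 s hs hs1 _ hDfc hDfs, hP3 s' hs' hs'1 f hfc hf,
      ts_inversion_dilate Δ hl hfc (hf.trans (ts_annulus_subset_compl_zero hs'))]
  · -- (RI) rotation invariance on each annulus
    intro L s hs hs1 A hA
    have hA' : MeasurableSet A := extEvents_le _ A hA
    have hrot : μ.map (rotateField L) = μ :=
      IsEuclideanInvariantLaw.isRotationInvariantLaw_holds hE L
    have hmr : Measurable (rotateField L) := (rotateField L).continuous.measurable
    rw [Measure.map_apply (FieldConfig.measurable_act _) (measurableSet_preimage hmr hA'),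
      Measure.map_apply (FieldConfig.measurable_act _) hA']
    conv_rhs => rw [← hrot, Measure.map_apply hmr
      (measurableSet_preimage (FieldConfig.measurable_act _) hA')]
    rw [← Set.preimage_comp, ← Set.preimage_comp]
    congr 1
    refine ts_preimage_eq_of_extEvents (fun f hf ω => ?_) hA
    have hfc : HasCompactSupport (f : EuclideanSpace ℝ (Fin 3) → ℝ) :=
      ts_hasCompactSupport_of_subset_annulus hf
    simp only [Function.comp_apply, FieldConfig.act_apply, rotateField_apply]
    rw [hP3 s hs hs1 _ (ts_hasCompactSupport_linActTest L.symm hfc) (ts_tsupport_linActTest_subset L.symm hf),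
      hP3 s hs hs1 f hfc hf,
      ts_inversion_rotate Δ L.symm hfc (hf.trans (ts_annulus_subset_compl_zero hs))]

end Summit.CriticalPhenomena.Ising3DConformalLimit.BallSpecificationBallSpecifiedInversionUpgrade
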